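import Mathlib.Analysis.SpecialFunctions.Pow.Continuity
import Mathlib.Analysis.SpecialFunctions.Pow.Real
import Mathlib.Topology.Order.OrderClosed

/-!
# A real-variable incompatibility: equal cross-ratios versus a flat and a linear mark

Helper file for route CardyAnchoredRigidity, item stmt-CriticalPhenomena-14488
(`StretchedPullbackNotTargetBlind`).

The elementary endgame of the proof. Two boundary correspondences produce, for every test
parameter `y ↓ 1`, four-tuples `(A₁, B₁, 0, Y₁ y)` and `(A₀, B₀, 0, Y₀ y)` of reals with EQUAL
cross-ratios, fixed `Aᵢ < Bᵢ < 0` and moving fourth marks `Yᵢ y ↓ 0`. Separating variables, the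
identity forces `Y₁ y ≥ κ Y₀ y` for a constant `κ > 0`; this is incompatible with `Y₁` being FLAT at
`1` (`Y₁ y = O((y-1)^{1+α})`, `α > 0`: the stretch centred at the target) while `Y₀` is LINEAR
(`Y₀ y ≥ c (y - 1)`: the stretch centred elsewhere). Pure real algebra; no named facts.
-/

noncomputable section

open Set Filter Topology

namespace Summit.CriticalPhenomena.CardyFormulaZ2.Theorems.StretchedPullback

/-- Cardy's cross-ratio of four reals, `(x₀ - x₁)(x₂ - x₃) / ((x₀ - x₂)(x₁ - x₃))`, as a function
of four arguments (the tree's `crossRatio` unfolded). -/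
def cr4 (x₀ x₁ x₂ x₃ : ℝ) : ℝ := (x₀ - x₁) * (x₂ - x₃) / ((x₀ - x₂) * (x₁ - x₃))

/-- **Separation of variables.** If `cr4 A₁ B₁ 0 Y₁ = cr4 A₀ B₀ 0 Y₀` with `Aᵢ < Bᵢ < 0 < Yᵢ` and
`Y₀ ≤ 1`, then `Y₁ ≥ κ Y₀` with the constant
`κ = (-B₁)((A₀ - B₀)A₁) / ((1 - B₀)((A₁ - B₁)A₀)) > 0`. -/
theorem le_of_cr4_eq {A₀ B₀ A₁ B₁ Y₀ Y₁ : ℝ} (hA₀ : A₀ < B₀) (hB₀ : B₀ < 0) (hA₁ : A₁ < B₁)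
    (hB₁ : B₁ < 0) (hY₀ : 0 < Y₀) (hY₀1 : Y₀ ≤ 1) (hY₁ : 0 < Y₁)
    (hid : cr4 A₁ B₁ 0 Y₁ = cr4 A₀ B₀ 0 Y₀) :
    (-B₁) * ((A₀ - B₀) * A₁) / ((1 - B₀) * ((A₁ - B₁) * A₀)) * Y₀ ≤ Y₁ := by
  have hM₀ : 0 < (A₁ - B₁) * A₀ := mul_pos_of_neg_of_neg (by linarith) (by linarith)
  have hM₁ : 0 < (A₀ - B₀) * A₁ := mul_pos_of_neg_of_neg (by linarith) (by linarith)
  have hden : 0 < (1 - B₀) * ((A₁ - B₁) * A₀) := mul_pos (by linarith) hM₀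
  -- clear denominators in the cross-ratio identity
  have hd₁ : (A₁ - 0) * (B₁ - Y₁) ≠ 0 := mul_ne_zero (by linarith) (by linarith)
  have hd₀ : (A₀ - 0) * (B₀ - Y₀) ≠ 0 := mul_ne_zero (by linarith) (by linarith)
  unfold cr4 at hid
  rw [div_eq_div_iff hd₁ hd₀] at hid
  have e1 : Y₁ * ((Y₀ - B₀) * ((A₁ - B₁) * A₀)) = Y₀ * ((Y₁ - B₁) * ((A₀ - B₀) * A₁)) := by
    linear_combination hid
  rw [div_mul_eq_mul_div, div_le_iff₀ hden]
  -- `(-B₁) M₁ Y₀ ≤ Y₀ (Y₁ - B₁) M₁ = Y₁ (Y₀ - B₀) M₀ ≤ Y₁ (1 - B₀) M₀`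
  have h1 : (-B₁) * ((A₀ - B₀) * A₁) * Y₀ ≤ Y₀ * ((Y₁ - B₁) * ((A₀ - B₀) * A₁)) := by
    have : 0 ≤ Y₀ * Y₁ * ((A₀ - B₀) * A₁) := by positivity
    nlinarith
  have h2 : Y₁ * ((Y₀ - B₀) * ((A₁ - B₁) * A₀)) ≤ Y₁ * ((1 - B₀) * ((A₁ - B₁) * A₀)) := by
    have : 0 ≤ Y₁ * (1 - Y₀) * ((A₁ - B₁) * A₀) :=
      mul_nonneg (mul_nonneg hY₁.le (by linarith)) hM₀.le
    nlinarith
  linarith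

/-- **The endgame.** Equal cross-ratios `cr4 A₁ B₁ 0 (Y₁ y) = cr4 A₀ B₀ 0 (Y₀ y)` for all
`y ∈ (1, 1 + δ)`, with `Aᵢ < Bᵢ < 0 < Yᵢ y`, `Y₀ y ≤ 1`, a FLAT bound `Y₁ y ≤ C (y - 1)^{1+α}`
(`α > 0`) and a LINEAR bound `c (y - 1) ≤ Y₀ y`, are contradictory. -/
theorem false_of_cr4_eq_of_flat_of_linear {α : ℝ} (hα : 0 < α) {A₀ B₀ A₁ B₁ : ℝ}
    (hA₀ : A₀ < B₀) (hB₀ : B₀ < 0) (hA₁ : A₁ < B₁) (hB₁ : B₁ < 0)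
    {Y₀ Y₁ : ℝ → ℝ} {δ C c : ℝ} (hδ : 0 < δ) (hc : 0 < c)
    (hY₀ : ∀ y ∈ Ioo 1 (1 + δ), 0 < Y₀ y) (hY₀1 : ∀ y ∈ Ioo 1 (1 + δ), Y₀ y ≤ 1)
    (hY₁ : ∀ y ∈ Ioo 1 (1 + δ), 0 < Y₁ y)
    (hid : ∀ y ∈ Ioo 1 (1 + δ), cr4 A₁ B₁ 0 (Y₁ y) = cr4 A₀ B₀ 0 (Y₀ y))
    (hflat : ∀ y ∈ Ioo 1 (1 + δ), Y₁ y ≤ C * (y - 1) ^ (1 + α))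
    (hlin : ∀ y ∈ Ioo 1 (1 + δ), c * (y - 1) ≤ Y₀ y) : False := by
  set κ : ℝ := (-B₁) * ((A₀ - B₀) * A₁) / ((1 - B₀) * ((A₁ - B₁) * A₀)) with hκ
  have hM₀ : 0 < (A₁ - B₁) * A₀ := mul_pos_of_neg_of_neg (by linarith) (by linarith)
  have hM₁ : 0 < (A₀ - B₀) * A₁ := mul_pos_of_neg_of_neg (by linarith) (by linarith)
  have hκpos : 0 < κ := div_pos (mul_pos (by linarith) hM₁) (mul_pos (by linarith) hM₀)
  -- for every test parameter: `κ c ≤ C (y - 1)^α`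
  have key : ∀ y ∈ Ioo 1 (1 + δ), κ * c ≤ C * (y - 1) ^ α := by
    intro y hy
    have ht : 0 < y - 1 := by linarith [hy.1]
    have h1 : κ * Y₀ y ≤ Y₁ y :=
      le_of_cr4_eq hA₀ hB₀ hA₁ hB₁ (hY₀ y hy) (hY₀1 y hy) (hY₁ y hy) (hid y hy)
    have h2 : κ * (c * (y - 1)) ≤ κ * Y₀ y := mul_le_mul_of_nonneg_left (hlin y hy) hκpos.le
    have h3 : Y₁ y ≤ C * (y - 1) ^ α * (y - 1) := by
      have := hflat y hy
      rwa [add_comm, Real.rpow_add_one ht.ne', ← mul_assoc] at this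
    have h4 : κ * c * (y - 1) ≤ C * (y - 1) ^ α * (y - 1) := by linarith
    exact le_of_mul_le_mul_right h4 ht
  -- but `(y - 1)^α → 0` as `y ↓ 1`
  have hlim : Tendsto (fun t : ℝ => C * t ^ α) (𝓝[>] 0) (𝓝 0) := by
    have h1 : Tendsto (fun t : ℝ => t ^ α) (𝓝 (0 : ℝ)) (𝓝 0) := by
      have := (Real.continuousAt_rpow_const 0 α (Or.inr hα.le)).tendsto
      rwa [Real.zero_rpow hα.ne'] at this
    have h2 := h1.const_mul C
    rw [mul_zero] at h2
    exact h2.mono_left nhdsWithin_le_nhds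
  have hev : ∀ᶠ t : ℝ in 𝓝[>] 0, C * t ^ α < κ * c :=
    hlim.eventually (Iio_mem_nhds (mul_pos hκpos hc))
  have hev' : ∀ᶠ t : ℝ in 𝓝[>] 0, t < δ := mem_nhdsWithin_of_mem_nhds (Iio_mem_nhds hδ)
  obtain ⟨t, ⟨ht1, ht2⟩, ht0⟩ := ((hev.and hev').and self_mem_nhdsWithin).exists
  have ht0' : (0 : ℝ) < t := ht0
  have := key (1 + t) ⟨by linarith, by linarith⟩
  rw [add_sub_cancel_left] at this
  linarith

end Summit.CriticalPhenomena.CardyFormulaZ2.Theorems.StretchedPullback
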